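import Summits.HodgeConjecture.HodgeConjecture.Theorems.GenericDivisibilityHodgeClassesGenericallyDivisible
import Literature.AlgebraicGeometry.HodgeTheory.HypersurfaceLefschetzIntegral
import Literature.AlgebraicTopology.SingularHomology.IntegralClassRingChange
import Literature.AlgebraicGeometry.HodgeTheory.LefschetzOneOneHolds
import Literature.AlgebraicGeometry.HodgeTheory.ZariskiOpenBettiFiniteness
import Summits.HodgeConjecture.HodgeConjecture.Theorems.GenericDivisibilityTorsionDiesGenerically

/-!
# Route GenericDivisibility — crux `HodgeClassesGenericallyDivisible` (C1, item stmt-HodgeConjecture-18466):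
# `hUCT` from finite generation, the pointwise form of "HC ⇒ C1", and C1 with finite coefficients

Companion to `Theorems/GenericDivisibilityHodgeClassesGenericallyDivisible` (the reductions
`hodgeClassesGenericallyDivisible_of_coniveau_one` / `_of_hodgeConjecture`, which take as hypothesis
`hUCT`: "an integral class on `(X ∖ Z)(ℂ)` with vanishing complexification is torsion").  The crux C1
itself is an OPEN PROBLEM for `p ≥ 2` (Hodge-conjecture strength: HC ⇒ C1 granted Colliot-Thélène–Voisin
2012 Thm. 3.1, and C1 ∧ C2 ⇒ HC by the route's `closes`); nothing here claims it.  What this file adds,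
sorry-free and on the route's own carriers:

* `genericDivisibility_exists_nsmul_eq_zero_of_ringChange_eq_zero` — `hUCT` IS the universal
  coefficient theorem: it follows from finite generation of `H_{2p-1}((X ∖ Z)(ℂ); ℤ)` alone
  (Hatcher Thm. 3.2: the kernel of the Kronecker map `Hⁿ → Hom(Hₙ, ℤ)` is `Ext(Hₙ₋₁, ℤ)`, torsion when
  `Hₙ₋₁` is finitely generated — the tree's PROVED `ker_kroneckerPairing_le_torsion` — and a class
  with `w ⊗ 1 = 0` pairs to zero with every integral cycle,
  `ringChange_ne_zero_of_kroneckerPairing_ne_zero`); `genericDivisibility_uct_of_finite` packages it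
  in the shape of `hUCT`, and `hodgeClassesGenericallyDivisible_of_hodgeConjecture_of_finite` is
  "HC ⇒ C1" granted only `TorsionDiesGenerically` and finite generation.  Finite generation of the
  integral homology of the complex points of a complex algebraic variety is a theorem in print
  (A. Dimca, *Singularities and Topology of Hypersurfaces* (1992), Ch. 1 Cor. (6.10): an algebraic
  variety has the homotopy type of a finite CW complex), vendored as the named fact
  `Dimca1992_finite_singularHomology_complexPointsCompl` (`HodgeTheory/ZariskiOpenBettiFiniteness`);
  the structural versions keep it as an explicit hypothesis `hfin`, and
  `hodgeClassesGenericallyDivisible_of_hodgeConjecture_of_facts` is the headline conditional result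
  "Dimca 1992 Cor. (6.10) ∧ Colliot-Thélène–Voisin 2012 Thm. 3.1 ∧ HC ⟹ C1", whose trust base is
  exactly these three registered statements.
* `genericDivisibility_exists_restrict_eq_zero_of_hodgeConjectureFor` — the POINTWISE form: from
  `HodgeConjectureFor (2p) X` for the one `X` (usable on the fourfolds where the tree knows HC), every
  integral middle class with `(p,p)` complexification dies integrally on a non-empty Zariski open.
* `hodgeClassesGenericallyDivisible_one` / `_one_of_facts` — the known case `p = 1` (surfaces):
  the Hodge conjecture for surfaces is a THEOREM of the tree (`hodgeConjectureFor_of_dim_le_three_holds`,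
  Lefschetz `(1,1)`), so C1 at `p = 1` holds granted only CT–Voisin Thm. 3.1 in degree `2` and finite
  generation of `H₁` of the Zariski opens.
* `hodgeClassesGenericallyDivisible_iff_reduceMod` — the finite-coefficient reading of C1: by
  exactness of the Bockstein sequence `Hⁿ(U; ℤ) →ᵐ Hⁿ(U; ℤ) → Hⁿ(U; ℤ/m)` (Hatcher §3.E; the tree's
  `exact_lsmul_reduceMod`), "divisible by `m` on `U(ℂ)`" is "zero modulo `m` on `U(ℂ)`", so C1 says
  exactly that the reduction of `z` modulo every `m` has coniveau `≥ 1` with `ℤ/m`-coefficients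
  ("Hodge classes are unramified-invisible").

References: A. Hatcher, *Algebraic Topology* (2002), §3.1 Thm. 3.2, p. 196, §3.E p. 303
[HatcherAT2002]; J.-L. Colliot-Thélène, C. Voisin, Duke Math. J. 161 (2012), Thm. 3.1
[ColliotTheleneVoisin2012]; A. Dimca (1992), Ch. 1 Cor. (6.10) [Dimca1992]; P. Deligne, *The Hodge
conjecture* (Clay 2000), §1 [Deligne2000].
-/

-- `Summit.HodgeConjecture.HodgeConjecture.Theorems` is the mandated namespace (single-problem summit:
-- Problem = Summit), which `linter.dupNamespace` flags on every declaration; the lakefile turns the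
-- linter off tree-wide (weak option), restated here so stand-alone elaboration is warning-free too.
set_option linter.dupNamespace false

noncomputable section

namespace Summit.HodgeConjecture.HodgeConjecture.Theorems

open CategoryTheory AlgebraicGeometry
open Literature.AlgebraicGeometry.Motives Literature.AlgebraicGeometry.HodgeTheory
  Literature.AlgebraicTopology.SingularHomology
open Summit.HodgeConjecture.HodgeConjecture.Theses.GenericDivisibility

/-! ### Universal coefficients: an integral class vanishing over `ℂ` is torsion -/

/-- **An integral class whose complexification vanishes is a torsion class** (when `Hₖ(U; ℤ)` is
finitely generated and `n = k + 1`): if `w ⊗ 1 = 0` in `Hⁿ(U; ℂ)` then every Kronecker pairing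
`⟨w, c⟩` with an integral cycle vanishes (`ringChange_ne_zero_of_kroneckerPairing_ne_zero`), so `w`
lies in the kernel of the Kronecker map `Hⁿ(U; ℤ) → Hom(Hₙ(U; ℤ), ℤ)`, i.e. in `Ext(Hₖ(U; ℤ), ℤ)`, a
torsion group for `Hₖ` finitely generated (Hatcher Thm. 3.2 and p. 196; the tree's
`ker_kroneckerPairing_le_torsion`), and a torsion element is killed by some `N ≥ 1`.
[cite: HatcherAT2002, §3.1 Thm. 3.2 and p. 196] -/
theorem genericDivisibility_exists_nsmul_eq_zero_of_ringChange_eq_zero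
    {U : Type} [TopologicalSpace U] {k n : ℕ} (hn : n = k + 1)
    [Module.Finite ℤ (singularHomology ℤ ℤ U k)] (w : singularCohomology ℤ ℤ U n)
    (hw : singularCohomology.ringChange (Int.castRingHom ℂ) U n w = 0) :
    ∃ N : ℕ, 1 ≤ N ∧ N • w = 0 := by
  subst hn
  -- every Kronecker pairing of `w` with an integral cycle vanishes, since `w ⊗ 1 = 0` over `ℂ`
  have hker : w ∈ LinearMap.ker (kroneckerPairing ℤ ℤ U (k + 1)) := by
    rw [LinearMap.mem_ker]
    refine LinearMap.ext fun c ↦ ?_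
    by_contra hc
    refine ringChange_ne_zero_of_kroneckerPairing_ne_zero ℂ w c hc ?_
    rw [algebraMap_int_eq]
    exact hw
  -- universal coefficients: the kernel of the Kronecker map is torsion (`Hₖ` finitely generated)
  have htors := ker_kroneckerPairing_le_torsion ℤ U k hker
  obtain ⟨⟨a, ha⟩, haw⟩ := (Submodule.mem_torsion_iff _).1 htors
  have haw' : a • w = 0 := by
    have h1 : (singularCohomology ℤ ℤ U (k + 1)).isModule.smul a w = 0 := haw
    rwa [int_smul_eq_zsmul] at h1
  refine ⟨a.natAbs, Int.natAbs_pos.2 (nonZeroDivisors.ne_zero ha), ?_⟩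
  rw [← natCast_zsmul]
  rcases Int.natAbs_eq a with h | h
  · rw [← h, haw']
  · rw [show ((a.natAbs : ℕ) : ℤ) = -a by omega, neg_zsmul, haw', neg_zero]

/-- **`hUCT` from finite generation.** If the integral homology of the complex points of every
non-empty Zariski open of every smooth projective complex variety is finitely generated (Dimca 1992,
Ch. 1 Cor. (6.10); hypothesis `hfin`), then the universal-coefficient hypothesis `hUCT` of
`hodgeClassesGenericallyDivisible_of_coniveau_one` holds: an integral middle-degree class on
`(X ∖ Z)(ℂ)` with vanishing complexification is killed by some `N ≥ 1`
(`genericDivisibility_exists_nsmul_eq_zero_of_ringChange_eq_zero` in degree `2p = (2p - 1) + 1`).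
[cite: HatcherAT2002, §3.1 Thm. 3.2 and p. 196] [cite: Dimca1992, Ch. 1 Cor. (6.10)] -/
theorem genericDivisibility_uct_of_finite
    (hfin : ∀ ⦃n : ℕ⦄ ⦃X : SchemeOver ℂ⦄, IsSmoothProjective n X →
      ∀ Z : Set X.left, IsClosed Z → Z ≠ Set.univ →
        ∀ k : ℕ, Module.Finite ℤ (singularHomology ℤ ℤ (complexPointsCompl X Z) k)) :
    ∀ ⦃p : ℕ⦄ ⦃X : SchemeOver ℂ⦄, 1 ≤ p → IsSmoothProjective (2 * p) X →
      ∀ (Z : Set X.left), IsClosed Z → Z ≠ Set.univ →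
        ∀ w : singularCohomology ℤ ℤ (complexPointsCompl X Z) (2 * p),
          singularCohomology.ringChange (Int.castRingHom ℂ) (complexPointsCompl X Z) (2 * p) w = 0 →
            ∃ N : ℕ, 1 ≤ N ∧ N • w = 0 := by
  intro p X hp hX Z hZ hZne w hw
  haveI := hfin hX Z hZ hZne (2 * p - 1)
  exact genericDivisibility_exists_nsmul_eq_zero_of_ringChange_eq_zero (k := 2 * p - 1) (by omega) w hw

/-- **HC ⇒ C1, granted only `TorsionDiesGenerically` and finite generation.** The Hodge conjecture
(summit statement, rational coefficients), the route's support item `TorsionDiesGenerically`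
(Colliot-Thélène–Voisin 2012, Thm. 3.1) and finite generation of the integral homology of the complex
points of the non-empty Zariski opens of smooth projective complex varieties (Dimca 1992, Ch. 1
Cor. (6.10), hypothesis `hfin`) imply the crux `HodgeClassesGenericallyDivisible`
(`hodgeClassesGenericallyDivisible_of_hodgeConjecture` with `hUCT` discharged by
`genericDivisibility_uct_of_finite`).  So a counterexample to C1 is a counterexample to the Hodge
conjecture detected at finite level, granted two printed theorems.
[cite: ColliotTheleneVoisin2012, Thm 3.1] [cite: Dimca1992, Ch. 1 Cor. (6.10)] -/
theorem hodgeClassesGenericallyDivisible_of_hodgeConjecture_of_finite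
    (hfin : ∀ ⦃n : ℕ⦄ ⦃X : SchemeOver ℂ⦄, IsSmoothProjective n X →
      ∀ Z : Set X.left, IsClosed Z → Z ≠ Set.univ →
        ∀ k : ℕ, Module.Finite ℤ (singularHomology ℤ ℤ (complexPointsCompl X Z) k))
    (hT : TorsionDiesGenerically) (hHC : _root_.HodgeConjecture) :
    HodgeClassesGenericallyDivisible :=
  hodgeClassesGenericallyDivisible_of_hodgeConjecture (genericDivisibility_uct_of_finite hfin) hT hHC

/-- **Pointwise form: HC for the one `2p`-fold `X` ⇒ its integral middle Hodge classes die on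
non-empty Zariski opens.** For `p ≥ 1`, `X` smooth projective of dimension `2p` with
`HodgeConjectureFor (2p) X`, granted `TorsionDiesGenerically` and finite generation of
`H_{2p-1}((X ∖ Z)(ℂ); ℤ)` for the proper closed `Z ⊆ X`: every `z ∈ H²ᵖ(X(ℂ); ℤ)` with `(p,p)`
complexification restricts to `0` on the complex points of some non-empty Zariski open (so C1 holds
for `X` with `y = 0`).  Proof: `z ⊗ 1` is rational (integral) and `(p,p)`, so HC puts it in
`algebraicClasses X p = Nᵖ ⊆ N¹`; it dies off one proper closed `Z`
(`genericDivisibility_exists_isClosed_ne_univ_of_mem_supportedClasses_one`), so `z|` has vanishing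
complexification there (`genericDivisibility_ringChange_map`), is torsion
(`genericDivisibility_exists_nsmul_eq_zero_of_ringChange_eq_zero`) and dies on a smaller open by
`TorsionDiesGenerically`. Usable on the fourfolds for which the tree knows HC.
[cite: ColliotTheleneVoisin2012, Thm 3.1] [cite: Deligne2000, §1] -/
theorem genericDivisibility_exists_restrict_eq_zero_of_hodgeConjectureFor
    {p : ℕ} {X : SchemeOver ℂ} (hp : 1 ≤ p) (hX : IsSmoothProjective (2 * p) X)
    (hHC : HodgeConjectureFor (2 * p) X) (hT : TorsionDiesGenerically)
    (hfin : ∀ Z : Set X.left, IsClosed Z → Z ≠ Set.univ →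
      Module.Finite ℤ (singularHomology ℤ ℤ (complexPointsCompl X Z) (2 * p - 1)))
    (z : singularCohomology ℤ ℤ (ComplexPoints X) (2 * p))
    (hz : IsOfHodgeType (2 * p) X (2 * p) p p
      (singularCohomology.ringChange (Int.castRingHom ℂ) (ComplexPoints X) (2 * p) z)) :
    ∃ Z : Set X.left, IsClosed Z ∧ Z ≠ Set.univ ∧
      singularCohomology.map ℤ ℤ
        (⟨Subtype.val, continuous_subtype_val⟩ : C(complexPointsCompl X Z, ComplexPoints X))
        (2 * p) z = 0 := by
  haveI := hX.geometricallyIrreducible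
  haveI : IrreducibleSpace X.left :=
    AlgebraicGeometry.GeometricallyIrreducible.irreducibleSpace_of_subsingleton X.hom
  have hint : IsIntegralClass
      (singularCohomology.ringChange (Int.castRingHom ℂ) (ComplexPoints X) (2 * p) z) :=
    (isIntegralClass_iff_mem_range_ringChange _).2 ⟨z, rfl⟩
  have hN1 := supportedClasses_mono X (2 * p) hp (hHC.2 p _ hint.isRationalClass hz)
  obtain ⟨Z, hZc, hZne, h0⟩ :=
    genericDivisibility_exists_isClosed_ne_univ_of_mem_supportedClasses_one hN1
  set w := singularCohomology.map ℤ ℤ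
    (⟨Subtype.val, continuous_subtype_val⟩ : C(complexPointsCompl X Z, ComplexPoints X)) (2 * p) z
    with hw_def
  have hw : singularCohomology.ringChange (Int.castRingHom ℂ) (complexPointsCompl X Z) (2 * p) w
      = 0 := by
    rw [hw_def, genericDivisibility_ringChange_map]
    exact h0
  haveI := hfin Z hZc hZne
  obtain ⟨N, hN, hNw⟩ :=
    genericDivisibility_exists_nsmul_eq_zero_of_ringChange_eq_zero (k := 2 * p - 1) (by omega) w hw
  obtain ⟨Z', hZZ', hZ'c, hZ'ne, h0'⟩ := hT hp hX Z hZc hZne w N hN hNw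
  refine ⟨Z', hZ'c, hZ'ne, ?_⟩
  rw [← genericDivisibility_restrict_restrict ℤ hZZ']
  exact h0'

/-! ### C1 with finite coefficients: divisible by `m` on `U(ℂ)` = zero modulo `m` on `U(ℂ)` -/

/-- **Divisible by `m` ⟺ zero modulo `m`** for an integral cohomology class (`m ≥ 1`): the
Bockstein sequence `Hⁿ(U; ℤ) →ᵐ Hⁿ(U; ℤ) →ρ Hⁿ(U; ℤ/m)` of `0 → ℤ →ᵐ ℤ → ℤ/m → 0` is exact at the
middle term and `ρ ∘ m = 0` (Hatcher §3.E p. 303; the tree's `exact_lsmul_reduceMod` and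
`mapCoeff_comp_mapCoeff_eq_zero`, with `(m·)_* = m • –`, `singularCohomology_mapCoeff_lsmul_eq_zsmul`).
[cite: HatcherAT2002, §3.E p. 303] -/
theorem genericDivisibility_exists_nsmul_eq_iff_reduceMod_eq_zero {U : Type} [TopologicalSpace U]
    (m n : ℕ) [NeZero m] (w : singularCohomology ℤ ℤ U n) :
    (∃ y : singularCohomology ℤ ℤ U n, m • y = w) ↔ reduceMod U m n w = 0 := by
  constructor
  · rintro ⟨y, rfl⟩
    have h0 := mapCoeff_comp_mapCoeff_eq_zero U (LinearMap.lsmul ℤ ℤ m) (intCastZModLinearMap m)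
      (exact_lsmul_intCast m).linearMap_comp_eq_zero n
    have h1 : reduceMod U m n (singularCohomology.mapCoeff U (LinearMap.lsmul ℤ ℤ m) n y) = 0 := by
      rw [← CategoryTheory.comp_apply, h0]
      rfl
    rwa [singularCohomology_mapCoeff_lsmul_eq_zsmul, natCast_zsmul] at h1
  · intro hw
    have hex := exact_lsmul_reduceMod U m n
    rw [ShortComplex.moduleCat_exact_iff] at hex
    obtain ⟨y, hy⟩ := hex w hw
    refine ⟨y, ?_⟩
    rw [← natCast_zsmul, ← singularCohomology_mapCoeff_lsmul_eq_zsmul m n y]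
    exact hy

/-- **C1 in finite coefficients.** `HodgeClassesGenericallyDivisible` is equivalent to: for `p ≥ 1`,
`X` a smooth projective complex `2p`-fold, `z ∈ H²ᵖ(X(ℂ); ℤ)` with `(p,p)` complexification and
every `m ≥ 1` (`[NeZero m]`), the reduction modulo `m` of `z` vanishes on the complex points of some
non-empty Zariski open `X ∖ Z` — i.e. `z mod m` has coniveau `≥ 1` with `ℤ/m`-coefficients, the
"unramified-invisible" reading of the item (pointwise Bockstein exactness on each `(X ∖ Z)(ℂ)`,
`genericDivisibility_exists_nsmul_eq_iff_reduceMod_eq_zero`, applied to `z|_{(X ∖ Z)(ℂ)}`).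
[cite: HatcherAT2002, §3.E p. 303] [cite: ColliotTheleneVoisin2012, Thm 3.1] -/
theorem hodgeClassesGenericallyDivisible_iff_reduceMod :
    HodgeClassesGenericallyDivisible ↔
      ∀ ⦃p : ℕ⦄ ⦃X : SchemeOver ℂ⦄, 1 ≤ p → IsSmoothProjective (2 * p) X →
        ∀ z : singularCohomology ℤ ℤ (ComplexPoints X) (2 * p),
          IsOfHodgeType (2 * p) X (2 * p) p p
            (singularCohomology.ringChange (Int.castRingHom ℂ) (ComplexPoints X) (2 * p) z) →
          ∀ (m : ℕ) [NeZero m], ∃ Z : Set X.left, IsClosed Z ∧ Z ≠ Set.univ ∧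
            reduceMod (complexPointsCompl X Z) m (2 * p)
              (singularCohomology.map ℤ ℤ
                (⟨Subtype.val, continuous_subtype_val⟩ :
                  C(complexPointsCompl X Z, ComplexPoints X)) (2 * p) z) = 0 := by
  constructor
  · intro h p X hp hX z hz m _
    obtain ⟨Z, hZ, hZne, y, hy⟩ := h hp hX z hz m (Nat.pos_of_ne_zero (NeZero.ne m))
    exact ⟨Z, hZ, hZne,
      (genericDivisibility_exists_nsmul_eq_iff_reduceMod_eq_zero m (2 * p) _).1 ⟨y, hy⟩⟩
  · intro h p X hp hX z hz m hm
    haveI : NeZero m := ⟨by omega⟩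
    obtain ⟨Z, hZ, hZne, h0⟩ := h hp hX z hz m
    obtain ⟨y, hy⟩ := (genericDivisibility_exists_nsmul_eq_iff_reduceMod_eq_zero m (2 * p) _).2 h0
    exact ⟨Z, hZ, hZne, y, hy⟩

/-! ### The known case `p = 1` (surfaces): C1 granted `TorsionDiesGenerically` and finite generation -/

/-- **C1 holds in the first case `p = 1` (smooth projective complex surfaces), granted
`TorsionDiesGenerically` and finite generation of `H₁` of the Zariski opens.** For `X` smooth
projective of dimension `2` over `ℂ`, an integral class `z ∈ H²(X(ℂ); ℤ)` with `(1,1)`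
complexification restricts to `0` on the complex points of some non-empty Zariski open — so for every
`m ≥ 1` it is `m • 0` there.  The Hodge conjecture for surfaces is a THEOREM of the tree
(`hodgeConjectureFor_of_dim_le_three_holds`: Lefschetz `(1,1)`, Voisin I Thm. 11.30, via Kodaira–Serre
and GAGA), so the pointwise reduction
`genericDivisibility_exists_restrict_eq_zero_of_hodgeConjectureFor` applies; what remains assumed is
Colliot-Thélène–Voisin Thm. 3.1 in degree `2` (the route item `TorsionDiesGenerically` at `p = 1`;
classically Kummer theory / Hilbert 90 for the torsion-freeness of `𝓗²(ℤ)`, cf. CT–Voisin §4.1: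
`0 → NS(X) → H²(X, ℤ) → H²_nr(X, ℤ) → 0`) and finite generation of `H₁((X ∖ Z)(ℂ); ℤ)` (Dimca 1992
Cor. (6.10)). [cite: VoisinHodgeI2002, Thm. 11.30] [cite: ColliotTheleneVoisin2012, Thm 3.1 and §4.1]
[cite: Dimca1992, Ch. 1 Cor. (6.10)] -/
theorem genericDivisibility_exists_restrict_eq_zero_surface (hT : TorsionDiesGenerically)
    {X : SchemeOver ℂ} (hX : IsSmoothProjective (2 * 1) X)
    (hfin : ∀ Z : Set X.left, IsClosed Z → Z ≠ Set.univ →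
      Module.Finite ℤ (singularHomology ℤ ℤ (complexPointsCompl X Z) 1))
    (z : singularCohomology ℤ ℤ (ComplexPoints X) (2 * 1))
    (hz : IsOfHodgeType (2 * 1) X (2 * 1) 1 1
      (singularCohomology.ringChange (Int.castRingHom ℂ) (ComplexPoints X) (2 * 1) z)) :
    ∃ Z : Set X.left, IsClosed Z ∧ Z ≠ Set.univ ∧
      singularCohomology.map ℤ ℤ
        (⟨Subtype.val, continuous_subtype_val⟩ : C(complexPointsCompl X Z, ComplexPoints X))
        (2 * 1) z = 0 :=
  genericDivisibility_exists_restrict_eq_zero_of_hodgeConjectureFor le_rfl hX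
    (hodgeConjectureFor_of_dim_le_three_holds (by norm_num) hX) hT hfin z hz

/-- **The `p = 1` instance of `HodgeClassesGenericallyDivisible`**, granted `TorsionDiesGenerically`
and finite generation of `H₁` of the non-empty Zariski opens of smooth projective surfaces: for every
`m ≥ 1` the witness is `y = 0` on the open of
`genericDivisibility_exists_restrict_eq_zero_surface`. This is the "p = 1 known in print" sector of
the crux (integral Lefschetz `(1,1)` + Kummer), here from the tree's unconditional Hodge conjecture
for surfaces. [cite: VoisinHodgeI2002, Thm. 11.30] [cite: ColliotTheleneVoisin2012, Thm 3.1 and §4.1] -/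
theorem hodgeClassesGenericallyDivisible_one (hT : TorsionDiesGenerically)
    (hfin : ∀ ⦃X : SchemeOver ℂ⦄, IsSmoothProjective (2 * 1) X →
      ∀ Z : Set X.left, IsClosed Z → Z ≠ Set.univ →
        Module.Finite ℤ (singularHomology ℤ ℤ (complexPointsCompl X Z) 1))
    ⦃X : SchemeOver ℂ⦄ (hX : IsSmoothProjective (2 * 1) X)
    (z : singularCohomology ℤ ℤ (ComplexPoints X) (2 * 1))
    (hz : IsOfHodgeType (2 * 1) X (2 * 1) 1 1
      (singularCohomology.ringChange (Int.castRingHom ℂ) (ComplexPoints X) (2 * 1) z))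
    (m : ℕ) (_hm : 1 ≤ m) :
    ∃ Z : Set X.left, IsClosed Z ∧ Z ≠ Set.univ ∧
      ∃ y : singularCohomology ℤ ℤ (complexPointsCompl X Z) (2 * 1),
        m • y = singularCohomology.map ℤ ℤ
          (⟨Subtype.val, continuous_subtype_val⟩ : C(complexPointsCompl X Z, ComplexPoints X))
          (2 * 1) z := by
  obtain ⟨Z, hZ, hZne, h0⟩ := genericDivisibility_exists_restrict_eq_zero_surface hT hX (hfin hX) z hz
  exact ⟨Z, hZ, hZne, 0, by rw [smul_zero]; exact h0.symm⟩

/-! ### Headline conditional results: trust base = registered named facts only -/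

/-- **Dimca 1992 Cor. (6.10) ∧ Colliot-Thélène–Voisin 2012 Thm. 3.1 ∧ HC ⟹ C1.** The crux
`HodgeClassesGenericallyDivisible` follows from the Hodge conjecture (summit statement) granted the two
printed theorems vendored in the tree as named facts:
`Dimca1992_finite_singularHomology_complexPointsCompl` (finite generation of the integral homology of
the Zariski opens of smooth projective complex varieties) and
`ColliotTheleneVoisin2012_torsionDiesGenerically` (torsion-freeness of the Zariski sheaf `𝓗²ᵖ(ℤ)`,
from the Rost–Voevodsky norm-residue theorem; = the route item `TorsionDiesGenerically`,
`genericDivisibility_torsionDiesGenerically_of_colliotTheleneVoisin`).  This is the formal content of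
"C1 is target-implied": refuting C1 refutes the Hodge conjecture, granted two theorems in print.
[cite: ColliotTheleneVoisin2012, Thm 3.1] [cite: Dimca1992, Ch. 1 Cor. (6.10)] [cite: Deligne2000, §1] -/
theorem hodgeClassesGenericallyDivisible_of_hodgeConjecture_of_facts
    (hfin : Dimca1992_finite_singularHomology_complexPointsCompl)
    (hT : ColliotTheleneVoisin2012_torsionDiesGenerically) (hHC : _root_.HodgeConjecture) :
    HodgeClassesGenericallyDivisible :=
  hodgeClassesGenericallyDivisible_of_hodgeConjecture_of_finite
    (fun _n _X hX Z hZ _ k ↦ hfin hX Z hZ k)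
    (genericDivisibility_torsionDiesGenerically_of_colliotTheleneVoisin hT) hHC

/-- **The `p = 1` instance of `HodgeClassesGenericallyDivisible` granted only the two printed
theorems** `Dimca1992_finite_singularHomology_complexPointsCompl` and
`ColliotTheleneVoisin2012_torsionDiesGenerically` (no Hodge-conjecture input: for surfaces HC is the
tree's theorem `hodgeConjectureFor_of_dim_le_three_holds`): an integral class with `(1,1)`
complexification on a smooth projective complex surface is, for every `m ≥ 1`, divisible by `m` (indeed
zero) on the complex points of some non-empty Zariski open. [cite: VoisinHodgeI2002, Thm. 11.30]
[cite: ColliotTheleneVoisin2012, Thm 3.1 and §4.1] [cite: Dimca1992, Ch. 1 Cor. (6.10)] -/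
theorem hodgeClassesGenericallyDivisible_one_of_facts
    (hfin : Dimca1992_finite_singularHomology_complexPointsCompl)
    (hT : ColliotTheleneVoisin2012_torsionDiesGenerically)
    ⦃X : SchemeOver ℂ⦄ (hX : IsSmoothProjective (2 * 1) X)
    (z : singularCohomology ℤ ℤ (ComplexPoints X) (2 * 1))
    (hz : IsOfHodgeType (2 * 1) X (2 * 1) 1 1
      (singularCohomology.ringChange (Int.castRingHom ℂ) (ComplexPoints X) (2 * 1) z))
    (m : ℕ) (hm : 1 ≤ m) :
    ∃ Z : Set X.left, IsClosed Z ∧ Z ≠ Set.univ ∧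
      ∃ y : singularCohomology ℤ ℤ (complexPointsCompl X Z) (2 * 1),
        m • y = singularCohomology.map ℤ ℤ
          (⟨Subtype.val, continuous_subtype_val⟩ : C(complexPointsCompl X Z, ComplexPoints X))
          (2 * 1) z :=
  hodgeClassesGenericallyDivisible_one
    (genericDivisibility_torsionDiesGenerically_of_colliotTheleneVoisin hT)
    (fun _X hX Z hZ _ ↦ hfin hX Z hZ 1) hX z hz m hm

end Summit.HodgeConjecture.HodgeConjecture.Theorems

end
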